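import Summits.ABC.ABC.Theorems.RibetTakahashiSplitFewPrimeValuationProductStubTwoLogOnePrimeWeak

/-!
# Stub `stub_twoLogOnePrime` (crux stmt-ABC-1563, line `matveev-face-clearing`): the LARGE-HEIGHT regime is a theorem

Support file (`--supports stmt-ABC-1563`, registered sub-goal `stub_twoLogOnePrime_largeHeight`). The open Transfer C⁺ of the line,

  `stub_twoLogOnePrime : ∃ η > 0, ∀ ε > 0, ∃ A C, … ℓ^ε ≤ z → z ≤ C ℓ^ε (log p log q (k+1))^A max(x,y)^{1-η}`,
  `z := ord_ℓ(p^x + σ 2^k q^y)`,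

follows from the WEAK Yu-defect form `stub_twoLogOnePrime_weak` (landed, from the LFL input `∃ K ≥ 1, PastenApproximationBound K`)
whenever the height is large against the prime: `ℓ · (1 + log(2·max(x,y) + 2)) ≤ max(x,y)^{1-η}`. Precisely, for EVERY real `η`
and every `ε > 0`, with `A = 2`:

  `stub_twoLogOnePrime_largeHeight : LFL → ∀ η ε, 0 < ε → ∃ C, ∀ …, ℓ·(1 + log(2 max(x,y) + 2)) ≤ max(x,y)^{1-η} →
      z ≤ C ℓ^ε (log p log q (k+1))^2 max(x,y)^{1-η}`.

So the open content of C⁺ is exactly the complementary window: superconvergent depth `z ≥ ℓ^ε` with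
`max(x,y)^{1-η} < ℓ · (1 + log(2 max(x,y) + 2))` — many small exponents against one large prime. (Bookkeeping used:
`1 + log(x+y+k+2) + log(log p + log q) ≤ 4 (k+1) (1 + log(2 max(x,y) + 2)) log p log q`, as `log p, log q ≥ 1`.)

Reference: H. Pasten, Invent. Math. 236 (2024), Thm 2.1 (the input); K. Yu, Forum Math. 19 (2007).
-/

-- `Summit.<Summit>.<Problem>`: for the single-conjunct summit `ABC` the duplicate `ABC.ABC` is mandated.
set_option linter.dupNamespace false

noncomputable section

open Real

namespace Summit.ABC.ABC.Theorems.FewPrimeValuationProduct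

/-- `1 ≤ log p` for `p ≥ 3` (since `e < 3`). [folklore] -/
private theorem one_le_log_of_three_le' {p : ℕ} (hp : 3 ≤ p) : 1 ≤ Real.log p := by
  rw [← Real.log_exp 1]
  apply Real.log_le_log (Real.exp_pos 1)
  have h3 : (3 : ℝ) ≤ p := by exact_mod_cast hp
  have := Real.exp_one_lt_d9
  linarith

/-- Height bookkeeping: `1 + log(x+y+k+2) + log(log p + log q) ≤ 4 (k+1) (1 + log(2 max(x,y) + 2)) · log p · log q` for
`log p, log q ≥ 1`. [folklore] -/
private theorem height_bookkeeping {x y k : ℕ} {Lp Lq : ℝ} (hLp : 1 ≤ Lp) (hLq : 1 ≤ Lq) :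
    1 + Real.log ((x + y + k + 2 : ℕ) : ℝ) + Real.log (Lp + Lq) ≤
      4 * ((k : ℝ) + 1) * (1 + Real.log (2 * ((max x y : ℕ) : ℝ) + 2)) * (Lp * Lq) := by
  set M : ℝ := ((max x y : ℕ) : ℝ) with hM
  have hM0 : 0 ≤ M := Nat.cast_nonneg _
  have hxM : (x : ℝ) ≤ M := by rw [hM]; exact_mod_cast le_max_left x y
  have hyM : (y : ℝ) ≤ M := by rw [hM]; exact_mod_cast le_max_right x y
  have hk0 : (0 : ℝ) ≤ k := Nat.cast_nonneg _
  set G : ℝ := 1 + Real.log (2 * M + 2) with hG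
  have hlogM : 0 ≤ Real.log (2 * M + 2) := Real.log_nonneg (by linarith)
  have hG1 : 1 ≤ G := by linarith
  -- `log (x+y+k+2) ≤ log ((2M+2)(k+1)) = log(2M+2) + log(k+1) ≤ log(2M+2) + k`
  have hS : ((x + y + k + 2 : ℕ) : ℝ) ≤ (2 * M + 2) * ((k : ℝ) + 1) := by
    push_cast
    nlinarith
  have hS0 : (0 : ℝ) < ((x + y + k + 2 : ℕ) : ℝ) := by positivity
  have hlogk : Real.log ((k : ℝ) + 1) ≤ k := by
    have := Real.log_le_sub_one_of_pos (show (0 : ℝ) < k + 1 by linarith); linarith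
  have h1 : Real.log ((x + y + k + 2 : ℕ) : ℝ) ≤ Real.log (2 * M + 2) + k := by
    calc Real.log ((x + y + k + 2 : ℕ) : ℝ) ≤ Real.log ((2 * M + 2) * ((k : ℝ) + 1)) :=
          Real.log_le_log hS0 hS
      _ = Real.log (2 * M + 2) + Real.log ((k : ℝ) + 1) := Real.log_mul (by linarith) (by linarith)
      _ ≤ Real.log (2 * M + 2) + k := by linarith
  -- `log (Lp + Lq) ≤ Lp + Lq ≤ 2 Lp Lq`
  have h2 : Real.log (Lp + Lq) ≤ 2 * (Lp * Lq) := by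
    have hl : Real.log (Lp + Lq) ≤ Lp + Lq := by
      have := Real.log_le_sub_one_of_pos (show 0 < Lp + Lq by linarith); linarith
    nlinarith
  -- assemble: `1 + (log(2M+2) + k) + 2 Lp Lq ≤ 4 (k+1) G Lp Lq`
  have hLL : 1 ≤ Lp * Lq := one_le_mul_of_one_le_of_one_le hLp hLq
  have hA : 1 + (Real.log (2 * M + 2) + k) ≤ ((k : ℝ) + 1) * G := by
    rw [hG]; nlinarith
  calc 1 + Real.log ((x + y + k + 2 : ℕ) : ℝ) + Real.log (Lp + Lq)
      ≤ ((k : ℝ) + 1) * G + 2 * (Lp * Lq) := by linarith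
    _ ≤ ((k : ℝ) + 1) * G * (Lp * Lq) * 2 + 2 * (Lp * Lq) * (((k : ℝ) + 1) * G) := by
        have hkG : 1 ≤ ((k : ℝ) + 1) * G := one_le_mul_of_one_le_of_one_le (by linarith) hG1
        nlinarith
    _ = 4 * ((k : ℝ) + 1) * G * (Lp * Lq) := by ring

/-- **`TwoLogOnePrime` holds in the large-height regime** (registered sub-goal `stub_twoLogOnePrime_largeHeight`): from the LFL
input, for every real `η` and every `ε > 0` there is `C` such that for distinct odd primes `ℓ, p, q`, `x, y ≥ 1`, `k`, `σ = ±1`,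
whenever `ℓ · (1 + log(2 max(x,y) + 2)) ≤ max(x,y)^{1-η}` one has
`ord_ℓ(p^x + σ 2^k q^y) ≤ C · ℓ^ε · (log p · log q · (k+1))^2 · max(x,y)^{1-η}` — the conclusion of the open stub
`stub_twoLogOnePrime` with `A = 2` (and without needing its superconvergence hypothesis). From `stub_twoLogOnePrime_weak`.
[cite: Pasten2024, Theorem 2.1] -/
theorem stub_twoLogOnePrime_largeHeight :
    (∃ K : ℝ, 1 ≤ K ∧ Literature.NumberTheory.DiophantineGeometry.Dioph.PastenApproximationBound K) → ∀ η ε : ℝ, 0 < ε → ∃ C : ℝ, ∀ ℓ p q : ℕ, ℓ.Prime → p.Prime → q.Prime → ℓ ≠ 2 → p ≠ 2 → q ≠ 2 → ℓ ≠ p → ℓ ≠ q → p ≠ q → ∀ x y k : ℕ, 1 ≤ x → 1 ≤ y → ∀ σ : ℤ, (σ = 1 ∨ σ = -1) → (ℓ : ℝ) * (1 + Real.log (2 * ((max x y : ℕ) : ℝ) + 2)) ≤ ((max x y : ℕ) : ℝ) ^ (1 - η) → (padicValInt ℓ ((p : ℤ) ^ x + σ * 2 ^ k * (q : ℤ) ^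 y) : ℝ) ≤ C * (ℓ : ℝ) ^ ε * (Real.log p * Real.log q * (k + 1)) ^ 2 * ((max x y : ℕ) : ℝ) ^ (1 - η) := by
  intro hL η ε hε
  obtain ⟨Cw, hCw⟩ := stub_twoLogOnePrime_weak hL
  refine ⟨4 * max Cw 0, ?_⟩
  intro ℓ p q hℓ hp hq hℓ2 hp2 hq2 hℓp hℓq hpq x y k hx hy σ hσ hreg
  have hw := hCw ℓ p q hℓ hp hq hℓ2 hp2 hq2 hℓp hℓq hpq x y k hx hy σ hσ
  -- notation
  set z : ℝ := (padicValInt ℓ ((p : ℤ) ^ x + σ * 2 ^ k * (q : ℤ) ^ y) : ℝ) with hz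
  set M : ℝ := ((max x y : ℕ) : ℝ) with hM
  set Lp : ℝ := Real.log p with hLp
  set Lq : ℝ := Real.log q with hLq
  set W : ℝ := 1 + Real.log ((x + y + k + 2 : ℕ) : ℝ) + Real.log (Lp + Lq) with hW
  set G : ℝ := 1 + Real.log (2 * M + 2) with hG
  have hp3 : 3 ≤ p := by have := hp.two_le; omega
  have hq3 : 3 ≤ q := by have := hq.two_le; omega
  have hLp1 : 1 ≤ Lp := one_le_log_of_three_le' hp3
  have hLq1 : 1 ≤ Lq := one_le_log_of_three_le' hq3
  have hℓ0 : (0 : ℝ) ≤ ℓ := Nat.cast_nonneg _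
  have hℓ1 : (1 : ℝ) ≤ ℓ := by exact_mod_cast hℓ.one_lt.le
  have hM0 : 0 ≤ M := Nat.cast_nonneg _
  have hk0 : (0 : ℝ) ≤ k := Nat.cast_nonneg _
  have hLL0 : 0 ≤ Lp * Lq := by nlinarith
  have hG1 : 1 ≤ G := by
    have : 0 ≤ Real.log (2 * M + 2) := Real.log_nonneg (by linarith)
    linarith
  have hCw0 : Cw ≤ max Cw 0 := le_max_left _ _
  have hC0 : 0 ≤ max Cw 0 := le_max_right _ _
  -- Step 1: the weak bound with `Cw ↦ max Cw 0` and the height bookkeeping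
  have hWle : W ≤ 4 * ((k : ℝ) + 1) * G * (Lp * Lq) := height_bookkeeping hLp1 hLq1
  have hW0 : 0 ≤ W := by
    have h1 : 0 ≤ Real.log ((x + y + k + 2 : ℕ) : ℝ) :=
      Real.log_nonneg (by exact_mod_cast (by omega : 1 ≤ x + y + k + 2))
    have h2 : 0 ≤ Real.log (Lp + Lq) := Real.log_nonneg (by linarith)
    rw [hW]; linarith
  have h1 : z ≤ max Cw 0 * ℓ * (Lp * Lq) * (4 * ((k : ℝ) + 1) * G * (Lp * Lq)) := by
    calc z ≤ Cw * ℓ * (Lp * Lq) * W := hw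
      _ ≤ max Cw 0 * ℓ * (Lp * Lq) * W := by
          apply mul_le_mul_of_nonneg_right _ hW0
          exact mul_le_mul_of_nonneg_right (mul_le_mul_of_nonneg_right hCw0 hℓ0) hLL0
      _ ≤ max Cw 0 * ℓ * (Lp * Lq) * (4 * ((k : ℝ) + 1) * G * (Lp * Lq)) := by
          apply mul_le_mul_of_nonneg_left hWle
          exact mul_nonneg (mul_nonneg hC0 hℓ0) hLL0
  -- Step 2: the regime hypothesis `ℓ G ≤ M^{1-η}` and `1 ≤ ℓ^ε`
  have hℓε : 1 ≤ (ℓ : ℝ) ^ ε := Real.one_le_rpow hℓ1 hε.le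
  have hMpow0 : 0 ≤ M ^ (1 - η) := Real.rpow_nonneg hM0 _
  have h2 : max Cw 0 * ℓ * (Lp * Lq) * (4 * ((k : ℝ) + 1) * G * (Lp * Lq)) =
      4 * max Cw 0 * ((ℓ : ℝ) * G) * ((Lp * Lq * ((k : ℝ) + 1)) * (Lp * Lq)) := by ring
  have hsq : (Lp * Lq * ((k : ℝ) + 1)) * (Lp * Lq) ≤ (Lp * Lq * ((k : ℝ) + 1)) ^ 2 := by
    have hk1 : 1 ≤ (k : ℝ) + 1 := by linarith
    have hbase : 0 ≤ Lp * Lq * ((k : ℝ) + 1) := mul_nonneg hLL0 (by linarith)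
    calc (Lp * Lq * ((k : ℝ) + 1)) * (Lp * Lq) ≤ (Lp * Lq * ((k : ℝ) + 1)) * (Lp * Lq * ((k : ℝ) + 1)) := by
          apply mul_le_mul_of_nonneg_left _ hbase
          exact le_mul_of_one_le_right hLL0 hk1
      _ = (Lp * Lq * ((k : ℝ) + 1)) ^ 2 := by ring
  have hP0 : 0 ≤ (Lp * Lq * ((k : ℝ) + 1)) ^ 2 := sq_nonneg _
  calc z ≤ 4 * max Cw 0 * ((ℓ : ℝ) * G) * ((Lp * Lq * ((k : ℝ) + 1)) * (Lp * Lq)) := h2 ▸ h1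
    _ ≤ 4 * max Cw 0 * M ^ (1 - η) * (Lp * Lq * ((k : ℝ) + 1)) ^ 2 := by
        apply mul_le_mul (mul_le_mul_of_nonneg_left hreg (by positivity)) hsq
          (mul_nonneg (mul_nonneg hLL0 (by linarith)) hLL0) (by positivity)
    _ ≤ 4 * max Cw 0 * ((ℓ : ℝ) ^ ε * M ^ (1 - η)) * (Lp * Lq * ((k : ℝ) + 1)) ^ 2 := by
        apply mul_le_mul_of_nonneg_right _ hP0
        apply mul_le_mul_of_nonneg_left _ (by positivity)
        exact le_mul_of_one_le_left hMpow0 hℓε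
    _ = 4 * max Cw 0 * (ℓ : ℝ) ^ ε * (Lp * Lq * ((k : ℝ) + 1)) ^ 2 * M ^ (1 - η) := by ring

end Summit.ABC.ABC.Theorems.FewPrimeValuationProduct

end
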